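import Mathlib
import HarnessLib
import Summits.HubbardSuperconductivity.HubbardSuperconductivity.Theorems.KLProgrammeH10TwoPointLimitPerturbedFermiRadius
import Summits.HubbardSuperconductivity.HubbardSuperconductivity.Theorems.KLProgrammeH10TwoPointLimitPolarGridCount

/-!
# Route `KLProgramme` — crux K1 `H10TwoPointLimit` (stmt-HubbardSuperconductivity-19938):
# cells and the «one determined leg» sector count ON THE PERTURBED FERMI CURVE, at every scale

Input (V) of Paper 1's Theorem 2.1 (the relative count with one determined leg, `lastLeg_count_le` of
`KLProgrammeH10TwoPointLimitRelativeSectorCount.lean`) and the cell geometry behind it were so far available for BGM's moving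
dispersion `E_h = ε₀ + δ_h` only through SHELL INCLUSION (`…PerturbedShell.lean`: radius `(η + η')/Dt_min + s_max α` with
`η' = sup|E - ε₀|`), which is useless below the scales `γ^h ≲ sup|δ_h| = O(|U|)` (cell gate-hubbard-kl GAP-LEDGER G-002,
dispositions D-G-002-ref3 / D-G-002-dag: the cumulative shift is `O(|U|)`, not `O(|U|γ^{2h}|h|)`). This file removes the `sup|δ|` loss: the
cells are taken around the PERTURBED curve `{ε₀ + δ = μ}` (any selection `u` of its Fermi points, file
`…PerturbedFermiRadius.lean`), and only the Lipschitz constant `κ₁ < Dt_min` of `δ` enters, through the factor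
`Dt_min/(Dt_min - κ₁)`:

* (generic polar-grid inputs — chord bound, «few grid points of a polar curve in a box», Lipschitz from a gradient bound —
  are in `KLProgrammeH10TwoPointLimitPolarGridCount.lean`);
* §3 **perturbed cells**: a momentum `k` of the closed square with `|ε₀(k) + δ(k) - μ| ≤ η` whose polar angle is within `α` of
  `θ₀` (mod `2π`) is within `(η + s_max Dt_min α)/(Dt_min - κ₁)` of the perturbed curve point `u(θ₀)·dir θ₀`, coordinatewise
  (`cell_perturbed`) — the free radius `η/Dt_min + s_max α` times `Dt_min/(Dt_min - κ₁)`, NO `sup|δ|` term; the mechanism is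
  the level-shift identity: `k`, `u(φ)·dir φ` and `u(θ₀)·dir θ₀` are free Fermi points of the levels `ε₀(k)`,
  `μ - δ(u(φ)·dir φ)`, `μ - δ(u(θ₀)·dir θ₀)`, and the level differences are controlled by `η` and by `κ₁ ×` the distances
  themselves (a fixed-point inequality);
* §4 **input (V) on the perturbed curve, all scales** (`lastLeg_count_perturbedCurve_le`): the number of sectors `ω` of width
  `w` containing a momentum of the `E`-shell `|E - μ| ≤ η` within `ρ` of a target is
  `≤ 3(2π√2(ρ + (η + s_max Dt_min α)/(Dt_min - κ₁))/(u_min w) + 1)`, uniformly in the target.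

Everything is PROVED; no definitions, no named facts. References: BGM 2006 §2.4 Lemma 2.1, §2.8 (2.89), App. A3
[cite: BenfattoGiulianiMastropietro2006]; BGM 2003 Lemmas 7.2–7.3 [cite: BenfattoGiulianiMastropietro2003]; HOME/prover-p4/
SECTOR-COUNTING-INTERFACE.md row (V), COUNTING-NOTE-2.md §5(b′).
-/

noncomputable section

namespace Summit.HubbardSuperconductivity.HubbardSuperconductivity.Theorems.PerturbedFermiCurve

set_option linter.dupNamespace false -- summit = problem name (single-conjunct summit), D-0017

open Classical
open Real Set
open Literature.MathematicalPhysics.QuantumLattice Literature.MathematicalPhysics.QuantumLattice.BandSectorCounting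

/-! ## §3 Cells around the perturbed Fermi curve -/

/-- A momentum of the closed square is the free Fermi point of its own level at its polar angle (shifted by any
multiple of `2π`): `k = u_{ε₀(k)}(φ)·dir φ`, `φ = arg k + 2πm`. [folklore] -/
theorem eq_bandFermiRadius_smul_dir_of_mem_square {a b : ℝ} (B : BandBounds a b) {k : Fin 2 → ℝ}
    (hk : ∀ i, |k i| ≤ π) (hν : sqDispersion k ∈ Icc a b) (m : ℤ) :
    k = bandFermiRadius (sqDispersion k) (Complex.arg (⟨k 0, k 1⟩ : ℂ) + m * (2 * π)) •
      dir (Complex.arg (⟨k 0, k 1⟩ : ℂ) + m * (2 * π)) := by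
  obtain ⟨hν₁, hν₂⟩ := B.level hν
  have hνeq : eps2 (k 0) (k 1) = sqDispersion k := by simp [sqDispersion, eps2]
  obtain ⟨hx, hy⟩ := band_eq_of_level hν₁ hν₂ (hk 0) (hk 1) hνeq
  have hper := band_add_int_mul_two_pi hν₁ hν₂ (Complex.arg (⟨k 0, k 1⟩ : ℂ)) m
  rw [← hper.1] at hx; rw [← hper.2.1] at hy
  ext i; fin_cases i
  · simpa [bandX, dir] using hx.symm
  · simpa [bandY, dir] using hy.symm

section Cell

variable {a b : ℝ} (B : BandBounds a b) {δ : (Fin 2 → ℝ) → ℝ} {κ₀ κ₁ μ : ℝ}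
  (hδ : ∀ k : Fin 2 → ℝ, (∀ i, |k i| ≤ π) → |δ k| ≤ κ₀)
  (hLip : ∀ k k' : Fin 2 → ℝ, (∀ i, |k i| ≤ π) → (∀ i, |k' i| ≤ π) → |δ k - δ k'| ≤ κ₁ * ‖k - k'‖)
  (hκ₁ : κ₁ < B.Dtmin) {u : ℝ → ℝ} (hu : ∀ θ, IsBandFermiRadius (μ - δ (u θ • dir θ)) θ (u θ))
include B hδ hLip hκ₁ hu

omit B hδ hκ₁ hu in
/-- The Lipschitz constant is non-negative (the square has two points at sup distance `π`). [folklore] -/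
theorem lipschitzConst_nonneg : 0 ≤ κ₁ := by
  have h := hLip (fun _ => 0) (fun _ => π) (by simp [Real.pi_pos.le]) (by simp [abs_of_pos Real.pi_pos])
  have hne : (fun _ : Fin 2 => (0 : ℝ)) - (fun _ => π) ≠ 0 := by
    intro h0
    have := congrFun h0 0
    simp [Real.pi_ne_zero] at this
  have hpos : 0 < ‖(fun _ : Fin 2 => (0 : ℝ)) - (fun _ => π)‖ := norm_pos_iff.2 hne
  by_contra hneg
  have := mul_neg_of_neg_of_pos (lt_of_not_ge hneg) hpos
  linarith [abs_nonneg (δ (fun _ => 0) - δ (fun _ => π))]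

/-- **Radial part of the perturbed cell**: a momentum `k` of the closed square with `|ε₀(k) + δ(k) - μ| ≤ η` and polar angle
`φ` (any determination) has polar radius within `η/(Dt_min - κ₁)` of the perturbed Fermi radius `u(φ)` on its ray — by the
level-shift identity both are free radii at `φ`, of levels differing by `(E(k) - μ) + (δ(u(φ)·dir φ) - δ(k))`, and the second
term is `≤ κ₁ ×` the distance itself. [cite: BenfattoGiulianiMastropietro2006, §2.4 Lemma 2.1] -/
theorem abs_radius_sub_root_le {k : Fin 2 → ℝ} {η : ℝ} (hk : ∀ i, |k i| ≤ π)
    (hshell : |sqDispersion k + δ k - μ| ≤ η) (hlo : a ≤ μ - κ₀ - η) (hhi : μ + κ₀ + η ≤ b) (m : ℤ) :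
    |bandFermiRadius (sqDispersion k) (Complex.arg (⟨k 0, k 1⟩ : ℂ) + m * (2 * π)) -
        u (Complex.arg (⟨k 0, k 1⟩ : ℂ) + m * (2 * π))| ≤ η / (B.Dtmin - κ₁) := by
  have hκ₁0 : 0 ≤ κ₁ := lipschitzConst_nonneg hLip
  obtain ⟨φ, hφ⟩ : ∃ φ, φ = Complex.arg (⟨k 0, k 1⟩ : ℂ) + m * (2 * π) := ⟨_, rfl⟩
  rw [← hφ]
  have hκ₀ : 0 ≤ κ₀ := (abs_nonneg _).trans (hδ k hk)
  have hη : 0 ≤ η := (abs_nonneg _).trans hshell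
  have hlo' : a ≤ μ - κ₀ := by linarith
  have hhi' : μ + κ₀ ≤ b := by linarith
  -- the two levels
  obtain ⟨ν, hν⟩ : ∃ ν, ν = sqDispersion k := ⟨_, rfl⟩
  have hνmem : ν ∈ Icc a b := by
    have h1 := abs_le.1 hshell; have h2 := abs_le.1 (hδ k hk)
    rw [hν]; constructor <;> linarith
  have hkeq : k = bandFermiRadius ν φ • dir φ := by
    rw [hν, hφ]; exact eq_bandFermiRadius_smul_dir_of_mem_square B hk (hν ▸ hνmem) m
  rw [← hν]
  obtain ⟨ν', hν'⟩ : ∃ ν', ν' = μ - δ (u φ • dir φ) := ⟨_, rfl⟩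
  have hν'mem : ν' ∈ Icc a b := hν' ▸ shiftedLevel_mem_Icc (hu φ) hδ hlo' hhi'
  have huφ : u φ = bandFermiRadius ν' φ := hν' ▸ eq_bandFermiRadius_of_shifted B hδ hlo' hhi' (hu φ)
  have hsq' : ∀ i, |(u φ • dir φ) i| ≤ π := abs_apply_le_pi_of_isBandFermiRadius (hu φ)
  -- Lipschitz in the level; the level difference
  have hrad : |bandFermiRadius ν φ - u φ| ≤ |ν - ν'| / B.Dtmin := by
    rw [huφ]; exact abs_bandFermiRadius_sub_le_of_level B hν'mem hνmem φ
  have hnorm : ‖u φ • dir φ - k‖ ≤ |bandFermiRadius ν φ - u φ| := by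
    rw [hkeq, ← sub_smul, norm_smul, Real.norm_eq_abs, abs_sub_comm]
    exact mul_le_of_le_one_right (abs_nonneg _) (norm_dir_le_one φ)
  have hδdiff : |δ (u φ • dir φ) - δ k| ≤ κ₁ * |bandFermiRadius ν φ - u φ| :=
    (hLip _ _ hsq' hk).trans (mul_le_mul_of_nonneg_left hnorm hκ₁0)
  have hlevel : |ν - ν'| ≤ η + κ₁ * |bandFermiRadius ν φ - u φ| := by
    have : ν - ν' = (sqDispersion k + δ k - μ) + (δ (u φ • dir φ) - δ k) := by rw [hν, hν']; ring
    rw [this]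
    exact (abs_add_le _ _).trans (add_le_add hshell hδdiff)
  -- the fixed-point inequality `d ≤ (η + κ₁ d)/Dt_min`
  have hDt := B.Dtmin_pos
  have h1 : |bandFermiRadius ν φ - u φ| ≤ (η + κ₁ * |bandFermiRadius ν φ - u φ|) / B.Dtmin :=
    hrad.trans (div_le_div_of_nonneg_right hlevel hDt.le)
  rw [le_div_iff₀ hDt] at h1
  rw [le_div_iff₀ (sub_pos.2 hκ₁)]
  nlinarith [abs_nonneg (bandFermiRadius ν φ - u φ)]

omit hLip hκ₁ in
/-- One coordinate of the angular comparison: for `c = cos` or `sin` (any `c` with `|c| ≤ 1` along which the free band curve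
is `s_max`-Lipschitz), `|u(φ) c(φ) - u(θ₀) c(θ₀)| ≤ s_max|φ - θ₀| + |ν_φ - ν_{θ₀}|/Dt_min` with the shifted levels `ν`. [folklore] -/
theorem abs_root_coord_sub_le {c : ℝ → ℝ} (hc : ∀ x, |c x| ≤ 1)
    (hspeed : ∀ ν ∈ Icc a b, ∀ θ θ' : ℝ, |bandFermiRadius ν θ * c θ - bandFermiRadius ν θ' * c θ'| ≤ B.smax * |θ - θ'|)
    (hlo : a ≤ μ - κ₀) (hhi : μ + κ₀ ≤ b) (φ θ₀ : ℝ) :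
    |u φ * c φ - u θ₀ * c θ₀| ≤ B.smax * |φ - θ₀| +
      |(μ - δ (u φ • dir φ)) - (μ - δ (u θ₀ • dir θ₀))| / B.Dtmin := by
  obtain ⟨νP, hνP⟩ : ∃ ν, ν = μ - δ (u φ • dir φ) := ⟨_, rfl⟩
  obtain ⟨νQ, hνQ⟩ : ∃ ν, ν = μ - δ (u θ₀ • dir θ₀) := ⟨_, rfl⟩
  rw [← hνP, ← hνQ]
  have hνPmem : νP ∈ Icc a b := hνP ▸ shiftedLevel_mem_Icc (hu φ) hδ hlo hhi
  have hνQmem : νQ ∈ Icc a b := hνQ ▸ shiftedLevel_mem_Icc (hu θ₀) hδ hlo hhi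
  have huφ : u φ = bandFermiRadius νP φ := hνP ▸ eq_bandFermiRadius_of_shifted B hδ hlo hhi (hu φ)
  have huθ : u θ₀ = bandFermiRadius νQ θ₀ := hνQ ▸ eq_bandFermiRadius_of_shifted B hδ hlo hhi (hu θ₀)
  have hrad := abs_bandFermiRadius_sub_le_of_level B hνQmem hνPmem θ₀
  rw [huφ, huθ]
  calc |bandFermiRadius νP φ * c φ - bandFermiRadius νQ θ₀ * c θ₀|
        = |(bandFermiRadius νP φ * c φ - bandFermiRadius νP θ₀ * c θ₀) +
            (bandFermiRadius νP θ₀ - bandFermiRadius νQ θ₀) * c θ₀| := by ring_nf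
    _ ≤ |bandFermiRadius νP φ * c φ - bandFermiRadius νP θ₀ * c θ₀| +
          |(bandFermiRadius νP θ₀ - bandFermiRadius νQ θ₀) * c θ₀| := abs_add_le _ _
    _ ≤ B.smax * |φ - θ₀| + |bandFermiRadius νP θ₀ - bandFermiRadius νQ θ₀| := by
        refine add_le_add (hspeed νP hνPmem φ θ₀) ?_
        rw [abs_mul]; exact mul_le_of_le_one_right (abs_nonneg _) (hc θ₀)
    _ ≤ B.smax * |φ - θ₀| + |νP - νQ| / B.Dtmin := by linarith [hrad]

/-- **Angular part of the perturbed cell**: two perturbed Fermi points `u(φ)·dir φ`, `u(θ₀)·dir θ₀` are within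
`s_max Dt_min |φ - θ₀|/(Dt_min - κ₁)` of each other in the sup norm (both are free Fermi points, of levels differing by
`≤ κ₁ ×` their distance; no derivative of `u` is used). [folklore] -/
theorem norm_root_sub_root_le (hlo : a ≤ μ - κ₀) (hhi : μ + κ₀ ≤ b) (φ θ₀ : ℝ) :
    ‖u φ • dir φ - u θ₀ • dir θ₀‖ ≤ B.smax * B.Dtmin * |φ - θ₀| / (B.Dtmin - κ₁) := by
  have hsqP : ∀ i, |(u φ • dir φ) i| ≤ π := abs_apply_le_pi_of_isBandFermiRadius (hu φ)
  have hsqQ : ∀ i, |(u θ₀ • dir θ₀) i| ≤ π := abs_apply_le_pi_of_isBandFermiRadius (hu θ₀)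
  have hDt := B.Dtmin_pos
  have hlev : |(μ - δ (u φ • dir φ)) - (μ - δ (u θ₀ • dir θ₀))| ≤ κ₁ * ‖u φ • dir φ - u θ₀ • dir θ₀‖ := by
    rw [show (μ - δ (u φ • dir φ)) - (μ - δ (u θ₀ • dir θ₀)) = -(δ (u φ • dir φ) - δ (u θ₀ • dir θ₀)) by ring, abs_neg]
    exact hLip _ _ hsqP hsqQ
  have hX := abs_root_coord_sub_le B hδ hu (c := Real.cos) Real.abs_cos_le_one
    (fun ν hν θ θ' => abs_bandX_sub_le B hν θ θ') hlo hhi φ θ₀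
  have hY := abs_root_coord_sub_le B hδ hu (c := Real.sin) Real.abs_sin_le_one
    (fun ν hν θ θ' => abs_bandY_sub_le B hν θ θ') hlo hhi φ θ₀
  -- the sup norm and the fixed-point inequality
  have hbound : ‖u φ • dir φ - u θ₀ • dir θ₀‖ ≤
      B.smax * |φ - θ₀| + κ₁ * ‖u φ • dir φ - u θ₀ • dir θ₀‖ / B.Dtmin := by
    have h0 : 0 ≤ B.smax * |φ - θ₀| + κ₁ * ‖u φ • dir φ - u θ₀ • dir θ₀‖ / B.Dtmin := by
      have : 0 ≤ κ₁ * ‖u φ • dir φ - u θ₀ • dir θ₀‖ := (abs_nonneg _).trans hlev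
      have := B.smax_pos
      positivity
    have hlev' := div_le_div_of_nonneg_right hlev hDt.le
    have hX2 : |u φ * Real.cos φ - u θ₀ * Real.cos θ₀| ≤
        B.smax * |φ - θ₀| + κ₁ * ‖u φ • dir φ - u θ₀ • dir θ₀‖ / B.Dtmin := hX.trans (by linarith)
    have hY2 : |u φ * Real.sin φ - u θ₀ * Real.sin θ₀| ≤
        B.smax * |φ - θ₀| + κ₁ * ‖u φ • dir φ - u θ₀ • dir θ₀‖ / B.Dtmin := hY.trans (by linarith)
    refine (pi_norm_le_iff_of_nonneg h0).2 fun i => ?_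
    fin_cases i
    · simpa [dir, Real.norm_eq_abs] using hX2
    · simpa [dir, Real.norm_eq_abs] using hY2
  rw [le_div_iff₀ (sub_pos.2 hκ₁)]
  have h1 := mul_le_mul_of_nonneg_right hbound hDt.le
  rw [add_mul, div_mul_cancel₀ _ hDt.ne'] at h1
  nlinarith [norm_nonneg (u φ • dir φ - u θ₀ • dir θ₀)]

/-- **Perturbed cell geometry, all scales** (BGM 2003 Lemmas 7.2–7.3 / BGM 2006 (2.69) on the INTERACTING curve): a momentum
`k` of the closed square with `|ε₀(k) + δ(k) - μ| ≤ η` (`μ ± (κ₀ + η)` in the level range) whose polar angle is within `α`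
of `θ₀` modulo `2π` is within `(η + s_max Dt_min α)/(Dt_min - κ₁)` of the perturbed curve point `u(θ₀)·dir θ₀`,
coordinatewise — no `sup|δ|` loss. [cite: BenfattoGiulianiMastropietro2006, §2.7 (2.69), §2.4 Lemma 2.1] -/
theorem cell_perturbed {k : Fin 2 → ℝ} {η α θ₀ : ℝ} {m : ℤ} (hk : ∀ i, |k i| ≤ π)
    (hshell : |sqDispersion k + δ k - μ| ≤ η) (hlo : a ≤ μ - κ₀ - η) (hhi : μ + κ₀ + η ≤ b)
    (hang : |Complex.arg (⟨k 0, k 1⟩ : ℂ) + m * (2 * π) - θ₀| ≤ α) (i : Fin 2) :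
    |k i - (u θ₀ • dir θ₀) i| ≤ (η + B.smax * B.Dtmin * α) / (B.Dtmin - κ₁) := by
  set φ := Complex.arg (⟨k 0, k 1⟩ : ℂ) + m * (2 * π) with hφ
  have hη : 0 ≤ η := (abs_nonneg _).trans hshell
  have hκ₀ : 0 ≤ κ₀ := (abs_nonneg _).trans (hδ k hk)
  have hlo' : a ≤ μ - κ₀ := by linarith
  have hhi' : μ + κ₀ ≤ b := by linarith
  have hν : sqDispersion k ∈ Icc a b := by
    have h1 := abs_le.1 hshell; have h2 := abs_le.1 (hδ k hk)
    constructor <;> linarith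
  have hkeq : k = bandFermiRadius (sqDispersion k) φ • dir φ := eq_bandFermiRadius_smul_dir_of_mem_square B hk hν m
  have hradial := abs_radius_sub_root_le B hδ hLip hκ₁ hu hk hshell hlo hhi m
  have hangular := norm_root_sub_root_le B hδ hLip hκ₁ hu hlo' hhi' φ θ₀
  have hden : 0 < B.Dtmin - κ₁ := sub_pos.2 hκ₁
  -- |k i - u φ dir φ i| ≤ radial deviation
  have h1 : |k i - (u φ • dir φ) i| ≤ η / (B.Dtmin - κ₁) := by
    have : k i - (u φ • dir φ) i = (bandFermiRadius (sqDispersion k) φ - u φ) * dir φ i := by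
      conv_lhs => rw [hkeq]
      simp only [Pi.smul_apply, smul_eq_mul]; ring
    rw [this, abs_mul]
    have hdi : |dir φ i| ≤ 1 := by
      fin_cases i
      · exact Real.abs_cos_le_one φ
      · exact Real.abs_sin_le_one φ
    calc |bandFermiRadius (sqDispersion k) φ - u φ| * |dir φ i| ≤ |bandFermiRadius (sqDispersion k) φ - u φ| * 1 :=
          mul_le_mul_of_nonneg_left hdi (abs_nonneg _)
      _ ≤ η / (B.Dtmin - κ₁) := by rw [mul_one]; exact hradial
  -- |u φ dir φ i - u θ₀ dir θ₀ i| ≤ angular deviation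
  have h2 : |(u φ • dir φ) i - (u θ₀ • dir θ₀) i| ≤ B.smax * B.Dtmin * α / (B.Dtmin - κ₁) := by
    have hle : |(u φ • dir φ) i - (u θ₀ • dir θ₀) i| ≤ ‖u φ • dir φ - u θ₀ • dir θ₀‖ := by
      rw [← Real.norm_eq_abs, ← Pi.sub_apply]; exact norm_le_pi_norm _ i
    refine hle.trans (hangular.trans ?_)
    have : 0 ≤ B.smax * B.Dtmin := (mul_pos B.smax_pos B.Dtmin_pos).le
    exact div_le_div_of_nonneg_right (mul_le_mul_of_nonneg_left hang this) hden.le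
  calc |k i - (u θ₀ • dir θ₀) i| = |(k i - (u φ • dir φ) i) + ((u φ • dir φ) i - (u θ₀ • dir θ₀) i)| := by ring_nf
    _ ≤ |k i - (u φ • dir φ) i| + |(u φ • dir φ) i - (u θ₀ • dir θ₀) i| := abs_add_le _ _
    _ ≤ η / (B.Dtmin - κ₁) + B.smax * B.Dtmin * α / (B.Dtmin - κ₁) := add_le_add h1 h2
    _ = (η + B.smax * B.Dtmin * α) / (B.Dtmin - κ₁) := by rw [add_div]

/-! ## §4 Input (V) on the perturbed curve: the last leg is determined, at every scale -/

/-- **The last leg is determined, on the PERTURBED curve** (input (V) of Paper 1's Theorem 2.1 for BGM's moving dispersion,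
all scales): the number of sectors `ω` of width `w` (`N w = 2π`) containing a momentum `k` of the `E`-shell `|ε₀ + δ - μ| ≤ η`
(`μ ± (κ₀ + η)` in the level range) within `ρ` of a target `(qx, qy)` is at most
`3 (2π√2(ρ + (η + s_max Dt_min α)/(Dt_min - κ₁))/(u_min w) + 1)`, uniformly in the target — the free bound of
`lastLeg_count_le` with the cell radius scaled by `Dt_min/(Dt_min - κ₁)`. [cite: BenfattoGiulianiMastropietro2006, §2.8 (2.89), App. A3] -/
theorem lastLeg_count_perturbedCurve_le {N : ℕ} {w : ℝ} (hw : 0 < w) (hN : (N : ℝ) * w = 2 * π)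
    {η α ρ : ℝ} (hα : 0 ≤ α) (hρ : 0 ≤ ρ) (hlo : a ≤ μ - κ₀ - η) (hhi : μ + κ₀ + η ≤ b) (hη : 0 ≤ η)
    (qx qy : ℝ) :
    ((((Finset.range N).filter fun ω : ℕ => ∃ k : Fin 2 → ℝ, (∀ i, |k i| ≤ π) ∧ |sqDispersion k + δ k - μ| ≤ η ∧
        (∃ m : ℤ, |Complex.arg (⟨k 0, k 1⟩ : ℂ) + m * (2 * π) - (w / 2 + ω * w)| ≤ α) ∧
        |k 0 - qx| ≤ ρ ∧ |k 1 - qy| ≤ ρ).card : ℝ)) ≤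
      3 * (2 * (π * (Real.sqrt 2 * (ρ + (η + B.smax * B.Dtmin * α) / (B.Dtmin - κ₁)) / B.umin)) / w + 1) := by
  have hκ₀ : 0 ≤ κ₀ := by
    have h := hu 0; exact (abs_nonneg _).trans (hδ _ (abs_apply_le_pi_of_isBandFermiRadius h))
  have hlo' : a ≤ μ - κ₀ := by linarith
  have hhi' : μ + κ₀ ≤ b := by linarith
  set r := (η + B.smax * B.Dtmin * α) / (B.Dtmin - κ₁) with hr
  have hr0 : 0 ≤ r := by
    have := B.Dtmin_pos; have := B.smax_pos; have := sub_pos.2 hκ₁; positivity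
  have hsub : ((Finset.range N).filter fun ω : ℕ => ∃ k : Fin 2 → ℝ, (∀ i, |k i| ≤ π) ∧ |sqDispersion k + δ k - μ| ≤ η ∧
        (∃ m : ℤ, |Complex.arg (⟨k 0, k 1⟩ : ℂ) + m * (2 * π) - (w / 2 + ω * w)| ≤ α) ∧
        |k 0 - qx| ≤ ρ ∧ |k 1 - qy| ≤ ρ) ⊆
      ((Finset.range N).filter fun ω : ℕ =>
        |u (w / 2 + ω * w) * Real.cos (w / 2 + ω * w) - qx| ≤ ρ + r ∧
          |u (w / 2 + ω * w) * Real.sin (w / 2 + ω * w) - qy| ≤ ρ + r) := by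
    intro ω hω
    rw [Finset.mem_filter] at hω ⊢
    refine ⟨hω.1, ?_⟩
    obtain ⟨k, hk, hshell, ⟨m, hang⟩, hx, hy⟩ := hω.2
    have hc := fun i => cell_perturbed B hδ hLip hκ₁ hu hk hshell hlo hhi hang i
    have hc0 := hc 0; have hc1 := hc 1
    simp only [Pi.smul_apply, smul_eq_mul, dir_zero, dir_one] at hc0 hc1
    constructor
    · calc |u (w / 2 + ω * w) * Real.cos (w / 2 + ω * w) - qx|
            = |(k 0 - qx) - (k 0 - u (w / 2 + ω * w) * Real.cos (w / 2 + ω * w))| := by ring_nf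
        _ ≤ |k 0 - qx| + |k 0 - u (w / 2 + ω * w) * Real.cos (w / 2 + ω * w)| := abs_sub _ _
        _ ≤ ρ + r := add_le_add hx hc0
    · calc |u (w / 2 + ω * w) * Real.sin (w / 2 + ω * w) - qy|
            = |(k 1 - qy) - (k 1 - u (w / 2 + ω * w) * Real.sin (w / 2 + ω * w))| := by ring_nf
        _ ≤ |k 1 - qy| + |k 1 - u (w / 2 + ω * w) * Real.sin (w / 2 + ω * w)| := abs_sub _ _
        _ ≤ ρ + r := add_le_add hy hc1
  have humin : ∀ θ, B.umin ≤ u θ := fun θ => umin_le_of_shifted B hδ hlo' hhi' (hu θ)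
  calc _ ≤ ((((Finset.range N).filter fun ω : ℕ =>
        |u (w / 2 + ω * w) * Real.cos (w / 2 + ω * w) - qx| ≤ ρ + r ∧
          |u (w / 2 + ω * w) * Real.sin (w / 2 + ω * w) - qy| ≤ ρ + r).card : ℝ)) := by
        exact_mod_cast Finset.card_le_card hsub
    _ ≤ _ := card_grid_in_box_le_radial B.umin_pos humin hw hN (add_nonneg hρ hr0)

/-- **The relative count with one determined leg ON THE PERTURBED CURVE, abstract form** (input (V) of Paper 1's Theorem 2.1
for the moving dispersion, all scales): the other legs range over arbitrary sets `A i` within `r i` of points `P i`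
(coordinatewise), signs `s i = ±1`; the last leg, of sign `t = ±1`, ranges over the `E`-cells of the grid angles
`θ_ω = w/2 + ω w` (`|ε₀ + δ - μ| ≤ η`, angular tolerance `α`). For every `G ∈ ℤ²` the number of `ω < N` admitting momenta with
`Σᵢ sᵢ kᵢ + t k = 2πG` is `≤ 3 (2π √2 (Σᵢ rᵢ + (η + s_max Dt_min α)/(Dt_min - κ₁))/(u_min w) + 1)` — independent of `G`, of the
`P i` and of the number of legs. [cite: BenfattoGiulianiMastropietro2006, §2.8 (2.83)–(2.96), App. A3] -/
theorem relCount_lastLeg_perturbedCurve_le {N : ℕ} {w : ℝ} (hw : 0 < w) (hN : (N : ℝ) * w = 2 * π)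
    {η α : ℝ} (hη : 0 ≤ η) (hα : 0 ≤ α) (hlo : a ≤ μ - κ₀ - η) (hhi : μ + κ₀ + η ≤ b)
    {M : ℕ} (A : Fin M → Set (Fin 2 → ℝ)) (P : Fin M → Fin 2 → ℝ) (r : Fin M → ℝ) (hr : ∀ i, 0 ≤ r i)
    (hA : ∀ i, ∀ k ∈ A i, ∀ c : Fin 2, |k c - P i c| ≤ r i)
    (s : Fin M → ℝ) (hs : ∀ i, s i = 1 ∨ s i = -1) (t : ℝ) (ht : t = 1 ∨ t = -1) (G : Fin 2 → ℤ) :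
    ((((Finset.range N).filter fun ω : ℕ => ∃ ks : Fin M → Fin 2 → ℝ, ∃ k : Fin 2 → ℝ,
        (∀ i, ks i ∈ A i) ∧ (∀ c, |k c| ≤ π) ∧ |sqDispersion k + δ k - μ| ≤ η ∧
        (∃ m : ℤ, |Complex.arg (⟨k 0, k 1⟩ : ℂ) + m * (2 * π) - (w / 2 + ω * w)| ≤ α) ∧
        ∀ c : Fin 2, (∑ i, s i * ks i c) + t * k c = 2 * π * G c).card : ℝ)) ≤
      3 * (2 * (π * (Real.sqrt 2 * ((∑ i, r i) + (η + B.smax * B.Dtmin * α) / (B.Dtmin - κ₁)) / B.umin)) / w + 1) := by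
  -- the target: `q = t (2πG - Σ sᵢ Pᵢ)`
  set q : Fin 2 → ℝ := fun c => t * (2 * π * G c - ∑ i, s i * P i c) with hq
  have hρ : 0 ≤ ∑ i, r i := Finset.sum_nonneg fun i _ => hr i
  have ht2 : t * t = 1 := by rcases ht with h | h <;> simp [h]
  have htabs : |t| = 1 := by rcases ht with h | h <;> simp [h]
  have hsub : ((Finset.range N).filter fun ω : ℕ => ∃ ks : Fin M → Fin 2 → ℝ, ∃ k : Fin 2 → ℝ,
        (∀ i, ks i ∈ A i) ∧ (∀ c, |k c| ≤ π) ∧ |sqDispersion k + δ k - μ| ≤ η ∧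
        (∃ m : ℤ, |Complex.arg (⟨k 0, k 1⟩ : ℂ) + m * (2 * π) - (w / 2 + ω * w)| ≤ α) ∧
        ∀ c : Fin 2, (∑ i, s i * ks i c) + t * k c = 2 * π * G c) ⊆
      ((Finset.range N).filter fun ω : ℕ => ∃ k : Fin 2 → ℝ, (∀ i, |k i| ≤ π) ∧ |sqDispersion k + δ k - μ| ≤ η ∧
        (∃ m : ℤ, |Complex.arg (⟨k 0, k 1⟩ : ℂ) + m * (2 * π) - (w / 2 + ω * w)| ≤ α) ∧
        |k 0 - q 0| ≤ (∑ i, r i) ∧ |k 1 - q 1| ≤ ∑ i, r i) := by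
    intro ω hω
    rw [Finset.mem_filter] at hω ⊢
    refine ⟨hω.1, ?_⟩
    obtain ⟨ks, k, hks, hk, hshell, hang, hsum⟩ := hω.2
    have key : ∀ c : Fin 2, |k c - q c| ≤ ∑ i, r i := by
      intro c
      have hkc : k c = t * (2 * π * G c - ∑ i, s i * ks i c) := by
        have h := congrArg (fun x => t * x) (hsum c)
        simp only [mul_add, ← mul_assoc, ht2, one_mul] at h
        linarith
      have hdiff : k c - q c = t * ∑ i, s i * (P i c - ks i c) := by
        rw [hkc, hq]
        simp only [mul_sub, Finset.mul_sum, Finset.sum_sub_distrib]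
        ring
      rw [hdiff, abs_mul, htabs, one_mul]
      refine (Finset.abs_sum_le_sum_abs _ _).trans (Finset.sum_le_sum fun i _ => ?_)
      have hsabs : |s i| = 1 := by rcases hs i with h | h <;> simp [h]
      rw [abs_mul, hsabs, one_mul, abs_sub_comm]
      exact hA i (ks i) (hks i) c
    exact ⟨k, hk, hshell, hang, key 0, key 1⟩
  calc _ ≤ ((((Finset.range N).filter fun ω : ℕ => ∃ k : Fin 2 → ℝ, (∀ i, |k i| ≤ π) ∧ |sqDispersion k + δ k - μ| ≤ η ∧
        (∃ m : ℤ, |Complex.arg (⟨k 0, k 1⟩ : ℂ) + m * (2 * π) - (w / 2 + ω * w)| ≤ α) ∧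
        |k 0 - q 0| ≤ (∑ i, r i) ∧ |k 1 - q 1| ≤ ∑ i, r i).card : ℝ)) := by
        exact_mod_cast Finset.card_le_card hsub
    _ ≤ _ := lastLeg_count_perturbedCurve_le B hδ hLip hκ₁ hu hw hN hα hρ hlo hhi hη (q 0) (q 1)

end Cell

end Summit.HubbardSuperconductivity.HubbardSuperconductivity.Theorems.PerturbedFermiCurve

end
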